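import Mathlib
import Literature.MathematicalPhysics.QuantumFieldTheory.Balaban1983to89.B12Decay510R1

/-!
# Bałaban, *Renormalization Group Approach to Lattice Gauge Field Theories. I* (CMP 109, 1987) — (5.10) p. 293
on the SITE LATTICE: cubes of side M, sites = lattice points (the geometric leaves of `B12Decay510` discharged at
the resolution of print)

[Balaban1987RG1] T. Bałaban, Commun. Math. Phys. **109** (1987) 249–301 (= "B12" of the cell census).  Companion
modules (all imported, none modified): `…Balaban1983to89.B12Decay510` (unit b03 gen 3: (5.10) kernel-derived from
NAMED LEAVES over an abstract `SiteGeometry C Λ`, printed example δ₁ = ½ min{δ₀, κM⁻¹}),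
`…Balaban1983to89.B12Decay510Window` (the leaves PROVED for the window system of `TreeLengthCubeSystem` with a site
identified with its cube — cell DIVERGENCE D-b03.11 (i)), `…Balaban1983to89.B12Decay510R1` (unit b03 gen 4: the
r = 1 term of (4.3)).

## What this module does (cell DIVERGENCE D-b03.11 (i), repaired)

p. 257, verbatim: *"We decompose the space T into the lattice of closed cubes of a size M, where M = Lᵐ, with
centers at points of the lattice T_M^{(j+m)}"* and *"A length of a shortest graph in this class, divided by M, is
the linear size of X, and is denoted by d_j(X). Thus we rescale the space, so that cubes from π_j become unit cubes,
and we take the distance in this scale."*  In (5.10) p. 293 the sites x, y are points of the unit lattice and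
∣x − y∣ is their lattice distance, while d_j(X) is measured in units of M — whence the printed δ₁ = ½ min{δ₀, κM⁻¹}.
The window instance of `B12Decay510Window` has no site lattice finer than the cubes.  Here the SITES are the
lattice points x ∈ ℤᵈ (`B13ScaleTransfer.Pt d`), the CUBE of index z ∈ ℤᵈ is {p : M zᵢ ≤ pᵢ ≤ M zᵢ + M − 1}
(side M ≥ 1, `cubeOf M p = z`), the window system, its localization domains and d_j := `TreeLength.treeLen` (tree
length in cube units = "divided by M") are those of `TreeLengthCubeSystem` UNCHANGED, and:
* Part 1 — one coordinate: the clamp of x into an integer interval [lo, hi] and the distance `distI lo hi x` to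
  it (`abs_sub_clampI`: the clamp attains it; `distI_le_abs_sub`: no point of the interval is closer).
* Part 2 — cubes of side M: `cubeOf`, the ℓ¹-nearest point `proj M z x` of the cube z to x, the ℓ¹ distance
  `distCube M x z` from a site to a cube (attained: `l1_sub_proj`; minimal: `distCube_le_l1_sub`), the KEY LOWER
  BOUND `l1_cubeOf_sub_le_distCube` (dist(x, □_z) ≥ ∣⌊x/M⌋ − z∣₁, uniformly in M ≥ 1), and the site-level
  diameter bound `l1_sub_le_treeLen_sites` (∣p − q∣₁ ≤ Md(d_j(X) + 3) for sites p, q of X, from the window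
  module's `l1_sub_le_treeLen` and ∣pᵢ − qᵢ∣ ≤ M∣aᵢ − bᵢ∣ + M − 1 for p ∈ □_a, q ∈ □_b).
* Part 3 — the `SiteGeometry` of the site lattice (`geomL B M`: dist(x, □) := `distCube`, dist(x, X) := min over
  the cubes of X, attained at `nearL`) and its three leaves PROVED: `geomLeafL` with (M′, c₁) = (M·d, 3);
  `cubeSumLeafL` with the M-UNIFORM constant K₁(d, a) of the window module (by the key lower bound and
  `B12Decay510Window.cubeSumLeaf` at the cube index ⌊x/M⌋); the tree leaf is `B12Decay510Window.treeLeaf` verbatim.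
* Part 4 — (5.10) on the site lattice: `abs_twoPoint_le_lattice` (one window) and `decay510_lattice` (an exhausting
  family + the limit (5.1)), landing in `B12Sec2to5.Decay510 P C (delta1 δ₀ κ (M·d))`, i.e. with
  δ₁ = ½ min{δ₀, κ(Md)⁻¹} and C = 4E₀α₂⁻²B₃² e^{3Mdδ₁} K₀(4·2ᵈ, 2d) K₁(d, δ₀/2); `decay510_lattice_r1` is the
  same with the r = 1 term of (4.3) kept (`B12Decay510R1.decay510_of_repr43_leaves`).
* Part 5 — the sup-metric reading, in which the printed constant appears ON THE NOSE: with ∣x − y∣ := the sup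
  lattice distance (Mathlib's `dist` on `Fin d → ℤ`) and dist(x, □), dist(x, X) the sup distances (`geomS B M`),
  the geometry leaf holds with (M, 3) (`geomLeafS`), the cube-sum leaf with K₁(d, a/d) (`cubeSumLeafS`), and
  `abs_twoPoint_le_lattice_sup` is (5.10) on one window with δ₁ = `delta1 δ₀ κ M` = ½ min{δ₀, κM⁻¹} exactly.

## DIVERGENCE (recorded in the cell file)

(i) The lattice norm of ∣x − y∣ in (5.10) and of dist^{(ξ)}(X, ·) in the p. 282 decay is not fixed by print at
these loci; Part 4 reads both as ℓ¹ (the tree's `B12Sec2to5.Decay510` is ℓ¹-typed) and then the printed M of δ₁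
appears as M·d, the factor d being the ℓ¹/sup conversion against the sup-metric tree length of `TreeLength`;
Part 5 reads both as sup distances and recovers ½ min{δ₀, κM⁻¹} literally (p. 293: *"with a positive constant δ₁
determined by δ₀, κ, and M (e.g., δ₁ = 1/2min{δ₀, κM⁻¹})"*; the use made of (5.10) right after (5.11) — *"it can
be extended as an analytic function to complex variables ζ_μ = p_μ + iq_μ, ∣q_μ∣ < δ₁"*, a polystrip — is what the
ℓ¹ reading delivers).  (ii) The window is a finite box of
cubes B ⊂ ℤᵈ exhausting ℤᵈ along the family (the torus T₁^{(j)} of print is replaced by windows, as in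
`B12Decay510Window`; the limit (5.1) is the hypothesis `hlim`).  (iii) c₁ = 3 (two half-open cubes of side M and
the +2 of the window module's sup-diameter bound); print displays no c₁.  Every analytic hypothesis — (4.4)
analyticity, (1.18), the representation (4.35) (or (4.3) with its r = 1 term, Part 4), the minimizer decay of
p. 282 / [15] Sect. G — is carried exactly as in `B12Decay510Window`; nothing of B12's analysis is asserted here.
-/

namespace Literature.MathematicalPhysics.QuantumFieldTheory.Balaban1983to89.B12Decay510Lattice

open Literature.MathematicalPhysics.QuantumFieldTheory.Balaban1983to89
open Literature.MathematicalPhysics.QuantumFieldTheory.Balaban1983to89.B13ScaleTransfer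
open Literature.MathematicalPhysics.QuantumFieldTheory.Balaban1983to89.TreeLength
open Literature.MathematicalPhysics.QuantumFieldTheory.Balaban1983to89.TreeLengthCubeSystem
open Literature.MathematicalPhysics.QuantumFieldTheory.Balaban1983to89.B12TreeDecay
open Literature.MathematicalPhysics.QuantumFieldTheory.Balaban1983to89.B12Decay510
open Literature.MathematicalPhysics.QuantumFieldTheory.Balaban1983to89.B12Decay510Window
open Literature.MathematicalPhysics.QuantumFieldTheory.Balaban1983to89.B12Decay510R1
open Literature.MathematicalPhysics.QuantumFieldTheory.Balaban1983to89.B12Sec2to5 (l1 l1_nonneg)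
open Set Metric Filter Topology

variable {d : ℕ}

/-! ## 1. One coordinate: an integer interval, its clamp and its distance function -/

/-- The clamp of x into the integer interval [lo, hi]. [folklore] -/
def clampI (lo hi x : ℤ) : ℤ := max lo (min x hi)

/-- The distance from x to the integer interval [lo, hi]. [folklore] -/
def distI (lo hi x : ℤ) : ℤ := max (lo - x) (max 0 (x - hi))

/-- lo ≤ clamp. [folklore] -/
theorem lo_le_clampI (lo hi x : ℤ) : lo ≤ clampI lo hi x := le_max_left _ _

/-- clamp ≤ hi (for a genuine interval). [folklore] -/
theorem clampI_le_hi {lo hi : ℤ} (h : lo ≤ hi) (x : ℤ) : clampI lo hi x ≤ hi := by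
  unfold clampI; omega

/-- The distance to an interval is non-negative. [folklore] -/
theorem distI_nonneg (lo hi x : ℤ) : 0 ≤ distI lo hi x := by
  unfold distI; omega

/-- **The clamp attains the distance**: ∣x − clamp(x)∣ = dist(x, [lo, hi]). [folklore] -/
theorem abs_sub_clampI {lo hi : ℤ} (h : lo ≤ hi) (x : ℤ) : |x - clampI lo hi x| = distI lo hi x := by
  unfold clampI distI; rw [abs_eq_max_neg]; omega

/-- **No point of the interval is closer**: dist(x, [lo, hi]) ≤ ∣x − p∣ for lo ≤ p ≤ hi. [folklore] -/
theorem distI_le_abs_sub {lo hi p : ℤ} (hp1 : lo ≤ p) (hp2 : p ≤ hi) (x : ℤ) : distI lo hi x ≤ |x - p| := by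
  unfold distI; rw [abs_eq_max_neg]; omega

/-! ## 2. Cubes of side M on the site lattice ℤᵈ -/

/-- The lower corner coordinate M zᵢ of the cube of index z. [cite: Balaban1987RG1, §0 p.257] -/
def clo (M : ℕ) (z : Pt d) (i : Fin d) : ℤ := (M : ℤ) * z i

/-- The upper corner coordinate M zᵢ + M − 1 of the cube of index z. [cite: Balaban1987RG1, §0 p.257] -/
def chi (M : ℕ) (z : Pt d) (i : Fin d) : ℤ := (M : ℤ) * z i + ((M : ℤ) - 1)

/-- **The cube index of a site**: ⌊x/M⌋ coordinatewise (p. 257: *"We decompose the space T into the lattice of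
closed cubes of a size M"*). [cite: Balaban1987RG1, §0 p.257] -/
def cubeOf (M : ℕ) (x : Pt d) : Pt d := fun i => x i / (M : ℤ)

/-- The ℓ¹- (and sup-) nearest site of the cube z to the site x: coordinatewise clamping.
[folklore] -/
def proj (M : ℕ) (z x : Pt d) : Pt d := fun i => clampI (clo M z i) (chi M z i) (x i)

/-- The ℓ¹ lattice distance from the site x to the cube z, as an integer. [cite: Balaban1987RG1, §0 p.257] -/
def distCubeZ (M : ℕ) (x z : Pt d) : ℤ := ∑ i, distI (clo M z i) (chi M z i) (x i)

/-- dist(x, □_z): the ℓ¹ lattice distance from the site x to the cube of index z. [cite: Balaban1987RG1, §0 p.257] -/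
def distCube (M : ℕ) (x z : Pt d) : ℝ := (distCubeZ M x z : ℝ)

variable {M : ℕ}

/-- A cube of positive side is a genuine box: M zᵢ ≤ M zᵢ + M − 1. [folklore] -/
theorem clo_le_chi (hM : 0 < M) (z : Pt d) (i : Fin d) : clo M z i ≤ chi M z i := by
  unfold clo chi
  have : (1 : ℤ) ≤ M := by exact_mod_cast hM
  linarith

/-- Every site lies in the cube of its index: M⌊xᵢ/M⌋ ≤ xᵢ ≤ M⌊xᵢ/M⌋ + M − 1. [folklore] -/
theorem mem_cube_cubeOf (hM : 0 < M) (x : Pt d) (i : Fin d) :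
    clo M (cubeOf M x) i ≤ x i ∧ x i ≤ chi M (cubeOf M x) i := by
  have hM' : (0 : ℤ) < M := by exact_mod_cast hM
  unfold clo chi cubeOf
  refine ⟨Int.mul_ediv_self_le hM'.ne', ?_⟩
  have := Int.lt_mul_ediv_self_add (x := x i) hM'
  linarith

/-- The index of the cube containing a site is determined by the box inequalities. [folklore] -/
theorem cubeOf_eq_of_mem (hM : 0 < M) {p z : Pt d} (h : ∀ i, clo M z i ≤ p i ∧ p i ≤ chi M z i) :
    cubeOf M p = z := by
  have hM' : (M : ℤ) ≠ 0 := by exact_mod_cast hM.ne'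
  funext i
  obtain ⟨h1, h2⟩ := h i
  unfold clo at h1
  unfold chi at h2
  show p i / (M : ℤ) = z i
  have hp : p i = (p i - M * z i) + z i * M := by ring
  rw [hp, Int.add_mul_ediv_right _ _ hM', Int.ediv_eq_zero_of_lt (by linarith) (by linarith), zero_add]

/-- The clamped site lies in the cube it was clamped into. [folklore] -/
theorem cubeOf_proj (hM : 0 < M) (z x : Pt d) : cubeOf M (proj M z x) = z :=
  cubeOf_eq_of_mem hM fun i => ⟨lo_le_clampI _ _ _, clampI_le_hi (clo_le_chi hM z i) _⟩

/-- dist(x, □) ≥ 0. [folklore] -/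
theorem distCube_nonneg (M : ℕ) (x z : Pt d) : 0 ≤ distCube M x z := by
  unfold distCube distCubeZ
  exact_mod_cast Finset.sum_nonneg fun i _ => distI_nonneg _ _ (x i)

/-- **dist(x, □_z) is attained at the clamped site**: ∣x − proj_z(x)∣₁ = dist(x, □_z). [folklore] -/
theorem l1_sub_proj (hM : 0 < M) (z x : Pt d) : l1 (x - proj M z x) = distCube M x z := by
  unfold l1 distCube distCubeZ
  rw [Int.cast_sum]
  refine Finset.sum_congr rfl fun i _ => ?_
  rw [Pi.sub_apply, ← Int.cast_abs]
  exact_mod_cast congrArg (fun t : ℤ => (t : ℝ)) (abs_sub_clampI (clo_le_chi hM z i) (x i))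

/-- **dist(x, □_z) is the distance to the cube**: no site of the cube is ℓ¹-closer. [folklore] -/
theorem distCube_le_l1_sub (hM : 0 < M) {p z : Pt d} (hp : cubeOf M p = z) (x : Pt d) :
    distCube M x z ≤ l1 (x - p) := by
  subst hp
  unfold l1 distCube distCubeZ
  rw [Int.cast_sum]
  refine Finset.sum_le_sum fun i _ => ?_
  rw [Pi.sub_apply, ← Int.cast_abs]
  exact_mod_cast distI_le_abs_sub (mem_cube_cubeOf hM p i).1 (mem_cube_cubeOf hM p i).2 (x i)

/-- **Key lower bound, one coordinate**: dist(xᵢ, [M zᵢ, M zᵢ + M − 1]) ≥ ∣⌊xᵢ/M⌋ − zᵢ∣ for M ≥ 1 (two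
distinct cubes are ≥ 1 apart per unit of index difference beyond the first, and ≥ 1 at the first). [folklore] -/
theorem abs_cubeOf_sub_le_distI (hM : 0 < M) (x z : Pt d) (i : Fin d) :
    |cubeOf M x i - z i| ≤ distI (clo M z i) (chi M z i) (x i) := by
  obtain ⟨h1, h2⟩ := mem_cube_cubeOf hM x i
  unfold clo at h1
  unfold chi at h2
  have hM1 : (1 : ℤ) ≤ M := by exact_mod_cast hM
  set c := cubeOf M x i with hc
  rcases lt_trichotomy (z i) c with hlt | heq | hgt
  · have hk : 0 ≤ c - z i - 1 := by omega
    have hprod : 0 ≤ ((M : ℤ) - 1) * (c - z i - 1) := mul_nonneg (by linarith) hk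
    calc |c - z i| = c - z i := abs_of_pos (by omega)
      _ ≤ x i - chi M z i := by unfold chi; nlinarith [hprod, h1]
      _ ≤ distI (clo M z i) (chi M z i) (x i) := le_max_of_le_right (le_max_right _ _)
  · rw [heq, sub_self, abs_zero]
    exact distI_nonneg _ _ _
  · have hk : 0 ≤ z i - c - 1 := by omega
    have hprod : 0 ≤ ((M : ℤ) - 1) * (z i - c - 1) := mul_nonneg (by linarith) hk
    calc |c - z i| = z i - c := by rw [abs_sub_comm]; exact abs_of_pos (by omega)
      _ ≤ clo M z i - x i := by unfold clo; nlinarith [hprod, h2]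
      _ ≤ distI (clo M z i) (chi M z i) (x i) := le_max_left _ _

/-- **Key lower bound**: dist(x, □_z) ≥ ∣⌊x/M⌋ − z∣₁, uniformly in the side M ≥ 1 — the cube sum over the site
lattice is dominated by the unit-cube sum of `B12Decay510Window`. [folklore] -/
theorem l1_cubeOf_sub_le_distCube (hM : 0 < M) (x z : Pt d) : l1 (cubeOf M x - z) ≤ distCube M x z := by
  unfold l1 distCube distCubeZ
  rw [Int.cast_sum]
  refine Finset.sum_le_sum fun i _ => ?_
  rw [Pi.sub_apply, ← Int.cast_abs]
  exact_mod_cast abs_cubeOf_sub_le_distI hM x z i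

/-- Two sites are coordinatewise within M·(index difference) + M − 1: ∣pᵢ − qᵢ∣ ≤ M∣aᵢ − bᵢ∣ + (M − 1) for
p ∈ □_a, q ∈ □_b. [folklore] -/
theorem abs_sub_le_of_cubeOf (hM : 0 < M) (p q : Pt d) (i : Fin d) :
    |p i - q i| ≤ (M : ℤ) * |cubeOf M p i - cubeOf M q i| + ((M : ℤ) - 1) := by
  obtain ⟨hp1, hp2⟩ := mem_cube_cubeOf hM p i
  obtain ⟨hq1, hq2⟩ := mem_cube_cubeOf hM q i
  unfold clo at hp1 hq1
  unfold chi at hp2 hq2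
  have hM0 : (0 : ℤ) ≤ M := by exact_mod_cast hM.le
  rw [abs_sub_le_iff]
  constructor
  · have h := mul_le_mul_of_nonneg_left (le_abs_self (cubeOf M p i - cubeOf M q i)) hM0
    rw [mul_sub] at h
    linarith
  · have h := mul_le_mul_of_nonneg_left (neg_le_abs (cubeOf M p i - cubeOf M q i)) hM0
    rw [neg_sub, mul_sub] at h
    linarith

/-- ∣p − q∣₁ ≤ M∣a − b∣₁ + d(M − 1) for sites p ∈ □_a, q ∈ □_b. [folklore] -/
theorem l1_sub_le_of_cubeOf (hM : 0 < M) (p q : Pt d) :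
    l1 (p - q) ≤ M * l1 (cubeOf M p - cubeOf M q) + d * ((M : ℝ) - 1) := by
  unfold l1
  rw [Finset.mul_sum]
  calc ∑ i, |((p - q) i : ℝ)| ≤ ∑ i : Fin d, ((M : ℝ) * |((cubeOf M p - cubeOf M q) i : ℝ)| + ((M : ℝ) - 1)) :=
        Finset.sum_le_sum fun i _ => by
          have h := abs_sub_le_of_cubeOf hM p q i
          have h' : ((|p i - q i| : ℤ) : ℝ) ≤ (((M : ℤ) * |cubeOf M p i - cubeOf M q i| + ((M : ℤ) - 1) : ℤ) : ℝ) := by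
            exact_mod_cast h
          push_cast at h'
          simpa only [Pi.sub_apply, Int.cast_sub] using h'
    _ = ∑ i : Fin d, (M : ℝ) * |((cubeOf M p - cubeOf M q) i : ℝ)| + d * ((M : ℝ) - 1) := by
        rw [Finset.sum_add_distrib, Finset.sum_const, Finset.card_univ, Fintype.card_fin, nsmul_eq_mul]

/-- **Site-level diameter of a localization domain**: ∣p − q∣₁ ≤ Md(d_j(X) + 3) for sites p, q lying in cubes
of X (the window module's `l1_sub_le_treeLen` — ∣a − b∣₁ ≤ d(d_j(X) + 2) for cubes a, b of X — and
`l1_sub_le_of_cubeOf`).  (Locus of the DEFINITION of d_j: p.257; the bound is derived here, not printed.)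
[folklore] -/
theorem l1_sub_le_treeLen_sites (hM : 0 < M) {X : Finset (Pt d)} (hX : X.Nonempty) (hc : FaceConnected X)
    {p q : Pt d} (hp : cubeOf M p ∈ X) (hq : cubeOf M q ∈ X) :
    l1 (p - q) ≤ (M : ℝ) * d * (treeLen X + 3) := by
  have h1 := l1_sub_le_of_cubeOf hM p q
  have h2 := l1_sub_le_treeLen hX hc hp hq
  have hM0 : (0 : ℝ) ≤ M := Nat.cast_nonneg M
  have hd0 : (0 : ℝ) ≤ d := Nat.cast_nonneg d
  have h3 := mul_le_mul_of_nonneg_left h2 hM0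
  nlinarith [h1, h3, hd0]

/-! ## 3. The site geometry of the lattice and its three leaves -/

/-- A cube of the domain X nearest to the site x exists (X is a non-empty finite family). [folklore] -/
theorem exists_nearL (M : ℕ) (B : Finset (Pt d)) (x : Pt d) (X : Dom B) :
    ∃ z ∈ X.1, ∀ z' ∈ X.1, distCube M x z ≤ distCube M x z' :=
  Finset.exists_min_image X.1 (fun z => distCube M x z) X.2.2.1

/-- A chosen cube of X nearest to the site x. [folklore] -/
noncomputable def nearL (M : ℕ) (B : Finset (Pt d)) (x : Pt d) (X : Dom B) : Pt d :=
  Classical.choose (exists_nearL M B x X)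

/-- The nearest cube belongs to the domain. [folklore] -/
theorem nearL_mem (M : ℕ) (B : Finset (Pt d)) (x : Pt d) (X : Dom B) : nearL M B x X ∈ X.1 :=
  (Classical.choose_spec (exists_nearL M B x X)).1

/-- The nearest cube minimizes the distance. [folklore] -/
theorem nearL_le (M : ℕ) (B : Finset (Pt d)) (x : Pt d) (X : Dom B) {z : Pt d} (hz : z ∈ X.1) :
    distCube M x (nearL M B x X) ≤ distCube M x z :=
  (Classical.choose_spec (exists_nearL M B x X)).2 z hz

/-- **The `SiteGeometry` of the site lattice** (p. 257: cubes of side M, localization domains = unions of cubes;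
p. 282 / (5.10): dist(X, ·) and ∣x − y∣ between sites) — sites := ℤᵈ, dist(x, □) := the ℓ¹ distance from the site
to the cube, dist(x, X) := min over the cubes of X, `pick x X` := a nearest cube. [cite: Balaban1987RG1, §0 p.257] -/
noncomputable def geomL (B : Finset (Pt d)) (M : ℕ) : SiteGeometry (cubeSys B).toCubeCover (Pt d) where
  distC := fun x c => distCube M x c.1
  distD := fun x X => distCube M x (nearL M B x X)
  distC_nonneg := fun x c => distCube_nonneg M x c.1
  distD_nonneg := fun x X => distCube_nonneg M x _
  pick := fun x X => ⟨nearL M B x X, X.2.1 (nearL_mem M B x X)⟩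
  pick_mem := fun x X => by
    show X ∈ (cubeSys B).above _
    rw [CubeSystem.mem_above]
    exact mem_cellsOf.2 (nearL_mem M B x X)
  distC_pick_le := fun _ _ => le_rfl

/-- dist(x, X) of the lattice geometry, unfolded. [folklore] -/
@[simp] theorem geomL_distD (B : Finset (Pt d)) (M : ℕ) (x : Pt d) (X : Dom B) :
    (geomL B M).distD x X = distCube M x (nearL M B x X) := rfl

/-- dist(x, □) of the lattice geometry, unfolded. [folklore] -/
@[simp] theorem geomL_distC (B : Finset (Pt d)) (M : ℕ) (x : Pt d) (c : Cell B) :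
    (geomL B M).distC x c = distCube M x c.1 := rfl

/-- **Leaf (b), the geometry leaf, PROVED on the site lattice**: ∣x − y∣₁ ≤ dist(x, X) + dist(y, X) +
Md(d_j(X) + 3) (`B12Decay510.geomLeaf_of_diam` on `l1_sub_le_treeLen_sites`, the nearest points being the
clamps into the nearest cubes). [cite: Balaban1987RG1, §0 p.257] -/
theorem geomLeafL (B : Finset (Pt d)) (hM : 0 < M) :
    GeomLeaf (geomL B M) (fun x y => l1 (x - y)) ((M : ℝ) * d) 3 := by
  refine geomLeaf_of_diam (geomL B M) (fun p (X : Dom B) => cubeOf M p ∈ X.1) (fun a b => l1_sub_comm a b)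
    (fun a b c => l1_sub_triangle a b c)
    (fun X p q hp hq => l1_sub_le_treeLen_sites hM X.2.2.1 X.2.2.2 hp hq)
    (fun x X => ⟨proj M (nearL M B x X) x, ?_, ?_⟩)
  · show cubeOf M (proj M (nearL M B x X) x) ∈ X.1
    rw [cubeOf_proj hM]
    exact nearL_mem M B x X
  · show l1 (x - proj M (nearL M B x X) x) ≤ distCube M x (nearL M B x X)
    rw [l1_sub_proj hM]

/-- **Leaf (c), the cube-sum leaf, PROVED on the site lattice with an M-uniform constant**:
Σ_□ e^{−a·dist(x, □)} ≤ Σ_{w∈ℤᵈ} e^{−a∣w∣₁} = K₁(d, a) for a > 0 (dist(x, □_z) ≥ ∣⌊x/M⌋ − z∣₁ and the window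
module's `cubeSumLeaf` at the cube index ⌊x/M⌋). [cite: Balaban1987RG1, (5.10) p.293] -/
theorem cubeSumLeafL (B : Finset (Pt d)) (hM : 0 < M) {a : ℝ} (ha : 0 < a) :
    CubeSumLeaf (geomL B M) a (K₁ d a) := by
  intro x
  refine le_trans (Finset.sum_le_sum fun c _ => ?_) (cubeSumLeaf B ha (cubeOf M x))
  rw [geomL_distC, geom_distC]
  have h := l1_cubeOf_sub_le_distCube hM x c.1
  exact Real.exp_le_exp.2 (by nlinarith [h, ha.le])

/-! ## 4. (5.10) on the site lattice, every geometric leaf discharged -/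

/-- **(5.10) on one window at the resolution of print** (sites = lattice points, cubes of side M ≥ 1): with the
terms analytic on the (4.4)-ball and bounded by E₀e^{−κd_j(X)} there ((1.18)), the kernel = the real part of the
mixed τ-derivative on the pair of minimizer responses ((4.35)), the responses bounded by B₃e^{−δ₀dist(x,X)}
(p. 282), δ₀ > 0 and κ ≥ 2κ₀(4·2ᵈ, 2d):
∣Σ_X 𝐄^{(2)}(X, x, y)∣ ≤ 4E₀α₂⁻²B₃² e^{3Mdδ₁} K₀ K₁(δ₀/2) e^{−δ₁∣x − y∣₁}, δ₁ = ½ min{δ₀, κ(Md)⁻¹}. [cite: Balaban1987RG1, (5.10) p.293] -/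
theorem abs_twoPoint_le_lattice (hd : 0 < d) (hM : 0 < M) (B : Finset (Pt d)) {W : Type*}
    [NormedAddCommGroup W] [NormedSpace ℂ W] (EX : Dom B → W → ℂ) (h : Dom B → Pt d → W)
    (E2 : Dom B → Pt d → Pt d → ℝ) {α₂ E₀ B₃ κ δ₀ : ℝ} (hα₂ : 0 < α₂) (hE₀ : 0 ≤ E₀) (hB₃ : 0 ≤ B₃)
    (hδ₀ : 0 < δ₀) (hκ : kappa₀ (4 * 2 ^ d) (2 * d) ≤ κ / 2)
    (han : ∀ X, AnalyticOnNhd ℂ (EX X) (ball 0 α₂))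
    (h118 : ∀ X, ∀ v ∈ ball (0 : W) α₂, ‖EX X v‖ ≤ E₀ * Real.exp (-κ * treeLen X.1))
    (hrepr : ∀ X x y, E2 X x y = (mixedDeriv (EX X) (h X x) (h X y)).re)
    (hh : ∀ X x, ‖h X x‖ ≤ B₃ * Real.exp (-δ₀ * distCube M x (nearL M B x X))) (x y : Pt d) :
    |∑ X : Dom B, E2 X x y| ≤ 4 * E₀ / α₂ ^ 2 * B₃ ^ 2 * Real.exp (delta1 δ₀ κ ((M : ℝ) * d) * ((M : ℝ) * d) * 3) *
      K₀ (4 * 2 ^ d) (2 * d) * K₁ d (δ₀ / 2) * Real.exp (-(delta1 δ₀ κ ((M : ℝ) * d)) * l1 (x - y)) := by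
  have hκ0 : 0 ≤ κ := by
    have := kappa₀_nonneg (c₀ := 4 * 2 ^ d) (by positivity) (2 * d)
    linarith
  have hMd : (0 : ℝ) < (M : ℝ) * d := mul_pos (Nat.cast_pos.2 hM) (Nat.cast_pos.2 hd)
  exact abs_twoPoint_le_of_analytic (S := sys B) (geomL B M) (ρ := fun x y => l1 (x - y)) EX h E2 hα₂ hE₀ hB₃
    (K₀_pos _ _).le hδ₀.le hκ0 hMd han h118 hrepr hh (geomLeafL B hM) (cubeSumLeafL B hM (half_pos hδ₀))
    (treeLeaf B hκ) x y

/-- **(5.10) = `B12Sec2to5.Decay510` at the resolution of print, every geometric leaf discharged**: an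
exhausting family of windows with cubes of side M ≥ 1 and sites the lattice points, the analytic hypotheses of
`B12Decay510Window.decay510_window` on each window (the minimizer decay now in the distance from the SITE to the
domain), and the limit (5.1) at the sites 0, z ⇒ `Decay510 P (4E₀α₂⁻²B₃² e^{3Mdδ₁} K₀(4·2ᵈ,2d) K₁(d, δ₀/2)) δ₁`
with δ₁ = `delta1 δ₀ κ (M·d)` = ½ min{δ₀, κ(Md)⁻¹} (module docstring, DIVERGENCE (i)). [cite: Balaban1987RG1, (5.10) p.293] -/
theorem decay510_lattice (hd : 0 < d) (hM : 0 < M) (B : ℕ → Finset (Pt d)) (Wn : ℕ → Type*)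
    [∀ n, NormedAddCommGroup (Wn n)] [∀ n, NormedSpace ℂ (Wn n)]
    (EXn : (n : ℕ) → Dom (B n) → Wn n → ℂ) (hn : (n : ℕ) → Dom (B n) → Pt d → Wn n)
    (E2n : (n : ℕ) → Dom (B n) → Pt d → Pt d → ℝ) (P : Pt d → ℝ) {α₂ E₀ B₃ κ δ₀ : ℝ}
    (hα₂ : 0 < α₂) (hE₀ : 0 ≤ E₀) (hB₃ : 0 ≤ B₃) (hδ₀ : 0 < δ₀) (hκ : kappa₀ (4 * 2 ^ d) (2 * d) ≤ κ / 2)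
    (han : ∀ n X, AnalyticOnNhd ℂ (EXn n X) (ball 0 α₂))
    (h118 : ∀ n X, ∀ v ∈ ball (0 : Wn n) α₂, ‖EXn n X v‖ ≤ E₀ * Real.exp (-κ * treeLen X.1))
    (hrepr : ∀ n X x y, E2n n X x y = (mixedDeriv (EXn n X) (hn n X x) (hn n X y)).re)
    (hh : ∀ n X x, ‖hn n X x‖ ≤ B₃ * Real.exp (-δ₀ * distCube M x (nearL M (B n) x X)))
    (hlim : ∀ z, Tendsto (fun n => ∑ X : Dom (B n), E2n n X 0 z) atTop (𝓝 (P z))) :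
    B12Sec2to5.Decay510 P (4 * E₀ / α₂ ^ 2 * B₃ ^ 2 * Real.exp (delta1 δ₀ κ ((M : ℝ) * d) * ((M : ℝ) * d) * 3) *
      K₀ (4 * 2 ^ d) (2 * d) * K₁ d (δ₀ / 2)) (delta1 δ₀ κ ((M : ℝ) * d)) := by
  have hκ0 : 0 ≤ κ := by
    have := kappa₀_nonneg (c₀ := 4 * 2 ^ d) (by positivity) (2 * d)
    linarith
  have hMd : (0 : ℝ) < (M : ℝ) * d := mul_pos (Nat.cast_pos.2 hM) (Nat.cast_pos.2 hd)
  refine decay510_of_analytic_leaves (fun n => sys (B n)) (fun n => (cubeSys (B n)).toCubeCover) (fun _ => Pt d)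
    (fun n => geomL (B n) M) (fun _ x y => l1 (x - y)) Wn EXn hn E2n (fun _ z => z) P hα₂ hE₀ hB₃ (K₀_pos _ _).le
    hδ₀.le hκ0 hMd han h118 hrepr hh (fun n => geomLeafL (B n) hM) (fun n => cubeSumLeafL (B n) hM (half_pos hδ₀))
    (fun n => treeLeaf (B n) hκ) (fun z => Eventually.of_forall fun n => ?_) hlim
  show l1 (0 - z) = l1 z
  rw [zero_sub, l1_neg]

/-- **(5.10) at the resolution of print with the r = 1 term of (4.3) kept** (`B12Decay510R1`): the same, the kernel
now the real part of the r = 2 plus the r = 1 members of (4.3) at n = 2, the r = 1 coefficient under the two-factor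
n(p) = 2 bound; C = (4E₀α₂⁻²B₃² + E₀α₂⁻¹B₃′) e^{3Mdδ₁} K₀ K₁, the same δ₁. [cite: Balaban1987RG1, (4.3) p.281 and (5.10) p.293] -/
theorem decay510_lattice_r1 (hd : 0 < d) (hM : 0 < M) (B : ℕ → Finset (Pt d)) (Wn : ℕ → Type*)
    [∀ n, NormedAddCommGroup (Wn n)] [∀ n, NormedSpace ℂ (Wn n)]
    (EXn : (n : ℕ) → Dom (B n) → Wn n → ℂ) (hn : (n : ℕ) → Dom (B n) → Pt d → Wn n)
    (h2n : (n : ℕ) → Dom (B n) → Pt d → Pt d → Wn n) (E2n : (n : ℕ) → Dom (B n) → Pt d → Pt d → ℝ)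
    (P : Pt d → ℝ) {α₂ E₀ B₃ B₃' κ δ₀ : ℝ} (hα₂ : 0 < α₂) (hE₀ : 0 ≤ E₀) (hB₃ : 0 ≤ B₃) (hB₃' : 0 ≤ B₃')
    (hδ₀ : 0 < δ₀) (hκ : kappa₀ (4 * 2 ^ d) (2 * d) ≤ κ / 2)
    (han : ∀ n X, AnalyticOnNhd ℂ (EXn n X) (ball 0 α₂))
    (h118 : ∀ n X, ∀ v ∈ ball (0 : Wn n) α₂, ‖EXn n X v‖ ≤ E₀ * Real.exp (-κ * treeLen X.1))
    (hrepr : ∀ n X x y, E2n n X x y =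
      (mixedDeriv (EXn n X) (hn n X x) (hn n X y)).re + (firstDeriv (EXn n X) (h2n n X x y)).re)
    (hh : ∀ n X x, ‖hn n X x‖ ≤ B₃ * Real.exp (-δ₀ * distCube M x (nearL M (B n) x X)))
    (hh2 : ∀ n X x y, ‖h2n n X x y‖ ≤ B₃' * Real.exp (-δ₀ * distCube M x (nearL M (B n) x X)) *
      Real.exp (-δ₀ * distCube M y (nearL M (B n) y X)))
    (hlim : ∀ z, Tendsto (fun n => ∑ X : Dom (B n), E2n n X 0 z) atTop (𝓝 (P z))) :
    B12Sec2to5.Decay510 P ((4 * E₀ / α₂ ^ 2 * B₃ ^ 2 + E₀ / α₂ * B₃') *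
      Real.exp (delta1 δ₀ κ ((M : ℝ) * d) * ((M : ℝ) * d) * 3) * K₀ (4 * 2 ^ d) (2 * d) * K₁ d (δ₀ / 2))
      (delta1 δ₀ κ ((M : ℝ) * d)) := by
  have hκ0 : 0 ≤ κ := by
    have := kappa₀_nonneg (c₀ := 4 * 2 ^ d) (by positivity) (2 * d)
    linarith
  have hMd : (0 : ℝ) < (M : ℝ) * d := mul_pos (Nat.cast_pos.2 hM) (Nat.cast_pos.2 hd)
  refine decay510_of_repr43_leaves (fun n => sys (B n)) (fun n => (cubeSys (B n)).toCubeCover) (fun _ => Pt d)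
    (fun n => geomL (B n) M) (fun _ x y => l1 (x - y)) Wn EXn hn h2n E2n (fun _ z => z) P hα₂ hE₀ hB₃ hB₃'
    (K₀_pos _ _).le hδ₀.le hκ0 hMd han h118 hrepr hh hh2 (fun n => geomLeafL (B n) hM)
    (fun n => cubeSumLeafL (B n) hM (half_pos hδ₀)) (fun n => treeLeaf (B n) hκ)
    (fun z => Eventually.of_forall fun n => ?_) hlim
  show l1 (0 - z) = l1 z
  rw [zero_sub, l1_neg]

/-! ## 5. The sup-metric reading: the printed δ₁ = ½ min{δ₀, κM⁻¹} on the nose -/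

/-- dist_∞(x, □_z): the sup lattice distance from the site x to the cube of index z (Mathlib's sup `dist` on
`Fin d → ℤ` to the clamped site, which is also the sup-nearest one). [cite: Balaban1987RG1, §0 p.257] -/
noncomputable def distCubeS (M : ℕ) (x z : Pt d) : ℝ := dist x (proj M z x)

/-- dist_∞(x, □) ≥ 0. [folklore] -/
theorem distCubeS_nonneg (M : ℕ) (x z : Pt d) : 0 ≤ distCubeS M x z := dist_nonneg

/-- One coordinate of the sup distance is the interval distance: dist(xᵢ, proj_z(x)ᵢ) = dist(xᵢ, [M zᵢ, M zᵢ + M − 1]).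
[folklore] -/
theorem dist_proj_apply (hM : 0 < M) (x z : Pt d) (i : Fin d) :
    dist (x i) (proj M z x i) = ((distI (clo M z i) (chi M z i) (x i) : ℤ) : ℝ) := by
  rw [Int.dist_eq, ← Int.cast_sub, ← Int.cast_abs]
  exact_mod_cast abs_sub_clampI (clo_le_chi hM z i) (x i)

/-- **dist_∞(x, □_z) is the sup distance to the cube**: no site of the cube is closer. [folklore] -/
theorem distCubeS_le_dist (hM : 0 < M) {p z : Pt d} (hp : cubeOf M p = z) (x : Pt d) :
    distCubeS M x z ≤ dist x p := by
  subst hp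
  unfold distCubeS
  rw [dist_pi_le_iff dist_nonneg]
  intro i
  calc dist (x i) (proj M (cubeOf M p) x i) = ((distI (clo M (cubeOf M p) i) (chi M (cubeOf M p) i) (x i) : ℤ) : ℝ) :=
        dist_proj_apply hM x _ i
    _ ≤ ((|x i - p i| : ℤ) : ℝ) := by
        exact_mod_cast distI_le_abs_sub (mem_cube_cubeOf hM p i).1 (mem_cube_cubeOf hM p i).2 (x i)
    _ = dist (x i) (p i) := by rw [Int.dist_eq, Int.cast_abs, Int.cast_sub]
    _ ≤ dist x p := dist_le_pi_dist x p i

/-- **Key lower bound, sup form**: ∣⌊x/M⌋ − z∣₁ ≤ d · dist_∞(x, □_z). [folklore] -/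
theorem l1_cubeOf_sub_le_mul_distCubeS (hM : 0 < M) (x z : Pt d) :
    l1 (cubeOf M x - z) ≤ d * distCubeS M x z := by
  unfold l1 distCubeS
  calc ∑ i, |((cubeOf M x - z) i : ℝ)| ≤ ∑ _i : Fin d, dist x (proj M z x) := Finset.sum_le_sum fun i _ => by
        rw [Pi.sub_apply, ← Int.cast_abs]
        calc ((|cubeOf M x i - z i| : ℤ) : ℝ) ≤ ((distI (clo M z i) (chi M z i) (x i) : ℤ) : ℝ) := by
              exact_mod_cast abs_cubeOf_sub_le_distI hM x z i
          _ = dist (x i) (proj M z x i) := (dist_proj_apply hM x z i).symm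
          _ ≤ dist x (proj M z x) := dist_le_pi_dist x (proj M z x) i
    _ = d * dist x (proj M z x) := by simp

/-- **Site-level sup-diameter of a localization domain**: dist_∞(p, q) ≤ M(d_j(X) + 3) for sites p, q in cubes of
X (the window module's `dist_corner_le_treeLen` — sup-distance of two cubes of X ≤ d_j(X) + 2 — and
`abs_sub_le_of_cubeOf`).  (Locus of the DEFINITION of d_j: p.257; the bound is derived here, not printed.)
[folklore] -/
theorem dist_le_treeLen_sites (hM : 0 < M) {X : Finset (Pt d)} (hX : X.Nonempty) (hc : FaceConnected X)
    {p q : Pt d} (hp : cubeOf M p ∈ X) (hq : cubeOf M q ∈ X) : dist p q ≤ (M : ℝ) * (treeLen X + 3) := by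
  have hab := dist_corner_le_treeLen hX hc hp hq
  have hM1 : (1 : ℝ) ≤ M := by exact_mod_cast hM
  have ht : 0 ≤ treeLen X + 2 := dist_nonneg.trans hab
  have hr : 0 ≤ (M : ℝ) * (treeLen X + 3) := by nlinarith
  rw [dist_pi_le_iff hr]
  intro i
  have h1 : |((p i : ℤ) : ℝ) - q i| ≤ (M : ℝ) * |((cubeOf M p i : ℤ) : ℝ) - cubeOf M q i| + ((M : ℝ) - 1) := by
    have := (Int.cast_le (R := ℝ)).2 (abs_sub_le_of_cubeOf hM p q i)
    push_cast at this
    exact this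
  have h2 : |((cubeOf M p i : ℤ) : ℝ) - cubeOf M q i| ≤ treeLen X + 2 := by
    have := dist_le_pi_dist (corner (cubeOf M p)) (corner (cubeOf M q)) i
    rw [Real.dist_eq] at this
    exact this.trans hab
  have hM0 : (0 : ℝ) ≤ M := by linarith
  rw [Int.dist_eq]
  nlinarith [mul_le_mul_of_nonneg_left h2 hM0, h1]

/-- A cube of X sup-nearest to the site x exists. [folklore] -/
theorem exists_nearS (M : ℕ) (B : Finset (Pt d)) (x : Pt d) (X : Dom B) :
    ∃ z ∈ X.1, ∀ z' ∈ X.1, distCubeS M x z ≤ distCubeS M x z' :=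
  Finset.exists_min_image X.1 (fun z => distCubeS M x z) X.2.2.1

/-- A chosen cube of X sup-nearest to the site x. [folklore] -/
noncomputable def nearS (M : ℕ) (B : Finset (Pt d)) (x : Pt d) (X : Dom B) : Pt d :=
  Classical.choose (exists_nearS M B x X)

/-- The sup-nearest cube belongs to the domain. [folklore] -/
theorem nearS_mem (M : ℕ) (B : Finset (Pt d)) (x : Pt d) (X : Dom B) : nearS M B x X ∈ X.1 :=
  (Classical.choose_spec (exists_nearS M B x X)).1

/-- The sup-nearest cube minimizes the sup distance. [folklore] -/
theorem nearS_le (M : ℕ) (B : Finset (Pt d)) (x : Pt d) (X : Dom B) {z : Pt d} (hz : z ∈ X.1) :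
    distCubeS M x (nearS M B x X) ≤ distCubeS M x z :=
  (Classical.choose_spec (exists_nearS M B x X)).2 z hz

/-- **The sup-metric `SiteGeometry` of the site lattice**: dist(x, □) := dist_∞(x, □), dist(x, X) := min over the
cubes of X. [cite: Balaban1987RG1, §0 p.257] -/
noncomputable def geomS (B : Finset (Pt d)) (M : ℕ) : SiteGeometry (cubeSys B).toCubeCover (Pt d) where
  distC := fun x c => distCubeS M x c.1
  distD := fun x X => distCubeS M x (nearS M B x X)
  distC_nonneg := fun x c => distCubeS_nonneg M x c.1
  distD_nonneg := fun x X => distCubeS_nonneg M x _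
  pick := fun x X => ⟨nearS M B x X, X.2.1 (nearS_mem M B x X)⟩
  pick_mem := fun x X => by
    show X ∈ (cubeSys B).above _
    rw [CubeSystem.mem_above]
    exact mem_cellsOf.2 (nearS_mem M B x X)
  distC_pick_le := fun _ _ => le_rfl

/-- dist(x, X) of the sup geometry, unfolded. [folklore] -/
@[simp] theorem geomS_distD (B : Finset (Pt d)) (M : ℕ) (x : Pt d) (X : Dom B) :
    (geomS B M).distD x X = distCubeS M x (nearS M B x X) := rfl

/-- dist(x, □) of the sup geometry, unfolded. [folklore] -/
@[simp] theorem geomS_distC (B : Finset (Pt d)) (M : ℕ) (x : Pt d) (c : Cell B) :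
    (geomS B M).distC x c = distCubeS M x c.1 := rfl

/-- **Leaf (b) in the sup metric with the printed M**: dist_∞(x, y) ≤ dist_∞(x, X) + dist_∞(y, X) + M(d_j(X) + 3).
[cite: Balaban1987RG1, §0 p.257] -/
theorem geomLeafS (B : Finset (Pt d)) (hM : 0 < M) : GeomLeaf (geomS B M) dist (M : ℝ) 3 := by
  refine geomLeaf_of_diam (geomS B M) (fun p (X : Dom B) => cubeOf M p ∈ X.1) (fun a b => dist_comm a b)
    (fun a b c => dist_triangle a b c)
    (fun X p q hp hq => dist_le_treeLen_sites hM X.2.2.1 X.2.2.2 hp hq)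
    (fun x X => ⟨proj M (nearS M B x X) x, ?_, le_rfl⟩)
  show cubeOf M (proj M (nearS M B x X) x) ∈ X.1
  rw [cubeOf_proj hM]
  exact nearS_mem M B x X

/-- **Leaf (c) in the sup metric**: Σ_□ e^{−a·dist_∞(x, □)} ≤ K₁(d, a/d) for a > 0, d ≥ 1 (∣⌊x/M⌋ − □∣₁ ≤
d·dist_∞(x, □) and the window module's `cubeSumLeaf` at rate a/d). [cite: Balaban1987RG1, (5.10) p.293] -/
theorem cubeSumLeafS (B : Finset (Pt d)) (hd : 0 < d) (hM : 0 < M) {a : ℝ} (ha : 0 < a) :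
    CubeSumLeaf (geomS B M) a (K₁ d (a / d)) := by
  have hd' : (0 : ℝ) < d := Nat.cast_pos.2 hd
  intro x
  refine le_trans (Finset.sum_le_sum fun c _ => ?_) (cubeSumLeaf B (div_pos ha hd') (cubeOf M x))
  rw [geomS_distC, geom_distC]
  have h := l1_cubeOf_sub_le_mul_distCubeS hM x c.1
  have h' : a / d * l1 (cubeOf M x - c.1) ≤ a * distCubeS M x c.1 := by
    rw [div_mul_eq_mul_div, div_le_iff₀ hd']
    nlinarith [h, ha.le]
  exact Real.exp_le_exp.2 (by linarith)

/-- **(5.10) on one window in the sup-metric reading — the printed constant**: with dist(x, X), dist(x, □) and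
∣x − y∣ all read as sup lattice distances, cubes of side M ≥ 1, and the analytic hypotheses of
`abs_twoPoint_le_lattice`:
∣Σ_X 𝐄^{(2)}(X, x, y)∣ ≤ 4E₀α₂⁻²B₃² e^{3Mδ₁} K₀(4·2ᵈ, 2d) K₁(d, δ₀/(2d)) e^{−δ₁ dist_∞(x, y)} with
δ₁ = `delta1 δ₀ κ M` = ½ min{δ₀, κM⁻¹} — p. 293 *"with a positive constant δ₁ determined by δ₀, κ, and M (e.g.,
δ₁ = 1/2min{δ₀, κM⁻¹})"* literally. [cite: Balaban1987RG1, (5.10) p.293] -/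
theorem abs_twoPoint_le_lattice_sup (hd : 0 < d) (hM : 0 < M) (B : Finset (Pt d)) {W : Type*}
    [NormedAddCommGroup W] [NormedSpace ℂ W] (EX : Dom B → W → ℂ) (h : Dom B → Pt d → W)
    (E2 : Dom B → Pt d → Pt d → ℝ) {α₂ E₀ B₃ κ δ₀ : ℝ} (hα₂ : 0 < α₂) (hE₀ : 0 ≤ E₀) (hB₃ : 0 ≤ B₃)
    (hδ₀ : 0 < δ₀) (hκ : kappa₀ (4 * 2 ^ d) (2 * d) ≤ κ / 2)
    (han : ∀ X, AnalyticOnNhd ℂ (EX X) (ball 0 α₂))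
    (h118 : ∀ X, ∀ v ∈ ball (0 : W) α₂, ‖EX X v‖ ≤ E₀ * Real.exp (-κ * treeLen X.1))
    (hrepr : ∀ X x y, E2 X x y = (mixedDeriv (EX X) (h X x) (h X y)).re)
    (hh : ∀ X x, ‖h X x‖ ≤ B₃ * Real.exp (-δ₀ * distCubeS M x (nearS M B x X))) (x y : Pt d) :
    |∑ X : Dom B, E2 X x y| ≤ 4 * E₀ / α₂ ^ 2 * B₃ ^ 2 * Real.exp (delta1 δ₀ κ M * M * 3) *
      K₀ (4 * 2 ^ d) (2 * d) * K₁ d (δ₀ / 2 / d) * Real.exp (-(delta1 δ₀ κ M) * dist x y) := by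
  have hκ0 : 0 ≤ κ := by
    have := kappa₀_nonneg (c₀ := 4 * 2 ^ d) (by positivity) (2 * d)
    linarith
  have hMR : (0 : ℝ) < M := Nat.cast_pos.2 hM
  exact abs_twoPoint_le_of_analytic (S := sys B) (geomS B M) (ρ := dist) EX h E2 hα₂ hE₀ hB₃
    (K₀_pos _ _).le hδ₀.le hκ0 hMR han h118 hrepr hh (geomLeafS B hM) (cubeSumLeafS B hd hM (half_pos hδ₀))
    (treeLeaf B hκ) x y

end Literature.MathematicalPhysics.QuantumFieldTheory.Balaban1983to89.B12Decay510Lattice
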